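import Mathlib
import Literature.Computability.AlgebraicComplexity.SetMultilinear
import Literature.Computability.AlgebraicComplexity.RealTauConjectureDepthFour

/-!
# `FeketeSOS.SOSMagnification` (stmt-ValiantsHypothesis-3995), line sml-polarised-transport — Stub T2 `stub_digitKronecker`

Digit lift versus inverse Kronecker substitution (Dutta–Saxena–Thierauf 2024, Remark 2 after
Thm 3.2, eqs. (7)–(8)), for the Fekete family with radix `k` and `n` digit blocks, variables
`y_{(j, ℓ)}`, `(j, ℓ) ∈ Fin n × Fin k` (block `j` = digit position):

* (a) for every `q ∈ ℂ[Fin n × Fin k]` whose monomials take at most one variable, to the first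
  power, from each block, the substitution `κ : y_{(j,ℓ)} ↦ X^{ℓ·k^j}` does not increase the number
  of monomials (`card_support_aeval_le_of_isTerm`) and `natDegree (κ q) ≤ Σ_{j<n} (k-1) k^j = k^n - 1`;
* (b) for a prime `p ≤ k^n` the one-hot digit lift `Σ_{m<p} (m|p) Π_{j<n} y_{(j, digit_j m)}`
  (`digit_j m = m / k^j % k`) is set-multilinear over all `n` blocks, has total degree exactly `n`
  (it is homogeneous of degree `n` and its coefficient at the digit monomial of `m = 1` is
  `(1|p) = 1`, base-`k` digits being unique below `k^n`), and `κ` maps it to the Fekete polynomial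
  `F_p = Σ_{m<p} (m|p) X^m` (base-`k` expansion `Σ_j digit_j(m) k^j = m` for `m < k^n`).

Everything is def-free; the helper lemmas are stated for an arbitrary digit assignment
`d : ℕ → Fin n → Fin k` and coefficient sequence `c : ℕ → ℂ`. [folklore]
-/

noncomputable section

namespace Summit.ValiantsHypothesis.ValiantsHypothesis.Theorems.FeketeSOSSOSMagnification

open MvPolynomial
open Literature.Computability.AlgebraicComplexity

-- `Summit.ValiantsHypothesis.ValiantsHypothesis.…` is the tree's mandated single-conjunct layout (Sub = Summit).
set_option linter.dupNamespace false

/-! ## (a) The inverse Kronecker substitution on block-sub-multilinear polynomials -/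

/-- Geometric sum in `ℕ`: `∑_{j<n} (k-1)·k^j ≤ k^n - 1` (equality for `k ≥ 1`). [folklore] -/
theorem dk_sum_pred_mul_pow_le (k n : ℕ) : ∑ j : Fin n, (k - 1) * k ^ (j : ℕ) ≤ k ^ n - 1 := by
  rw [Fin.sum_univ_eq_sum_range (fun j => (k - 1) * k ^ j) n, ← Finset.mul_sum]
  rcases Nat.eq_zero_or_pos k with rfl | hk
  · simp
  · rw [mul_comm, geom_sum_mul_of_one_le hk n]

/-- The exponent of `κ (y^m)` for a block-sub-multilinear monomial `m` (at most one variable, to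
the first power, from each block) is at most `∑_{j<n} (k-1) k^j ≤ k^n - 1`. [folklore] -/
theorem dk_expo_le (n k : ℕ) (m : Fin n × Fin k →₀ ℕ) (hm : ∀ j : Fin n, ∑ l : Fin k, m (j, l) ≤ 1) :
    ∑ v ∈ m.support, m v * ((v.2 : ℕ) * k ^ (v.1 : ℕ)) ≤ k ^ n - 1 := by
  calc ∑ v ∈ m.support, m v * ((v.2 : ℕ) * k ^ (v.1 : ℕ))
      ≤ ∑ v, m v * ((v.2 : ℕ) * k ^ (v.1 : ℕ)) :=
        Finset.sum_le_sum_of_subset_of_nonneg (Finset.subset_univ _) fun _ _ _ => Nat.zero_le _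
    _ = ∑ j : Fin n, ∑ l : Fin k, m (j, l) * ((l : ℕ) * k ^ (j : ℕ)) := Fintype.sum_prod_type _
    _ ≤ ∑ j : Fin n, ∑ l : Fin k, m (j, l) * ((k - 1) * k ^ (j : ℕ)) := by
        gcongr with j _ l _
        exact Nat.le_sub_one_of_lt l.isLt
    _ = ∑ j : Fin n, (∑ l : Fin k, m (j, l)) * ((k - 1) * k ^ (j : ℕ)) := by
        simp_rw [Finset.sum_mul]
    _ ≤ ∑ j : Fin n, 1 * ((k - 1) * k ^ (j : ℕ)) := by
        gcongr with j _
        exact hm j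
    _ = ∑ j : Fin n, (k - 1) * k ^ (j : ℕ) := by simp_rw [one_mul]
    _ ≤ k ^ n - 1 := dk_sum_pred_mul_pow_le k n

/-- `natDegree (κ (c·y^m)) ≤ Σ_v m(v)·(v.2·k^{v.1})`, the exponent of the term `κ (y^m)`. [folklore] -/
theorem dk_natDegree_aeval_monomial_le (n k : ℕ) (m : Fin n × Fin k →₀ ℕ) (c : ℂ) :
    (MvPolynomial.aeval
        (fun v : Fin n × Fin k => (Polynomial.X : Polynomial ℂ) ^ ((v.2 : ℕ) * k ^ (v.1 : ℕ)))
        (monomial m c)).natDegree ≤ ∑ v ∈ m.support, m v * ((v.2 : ℕ) * k ^ (v.1 : ℕ)) := by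
  rw [MvPolynomial.aeval_monomial, ← Polynomial.C_eq_algebraMap, Finsupp.prod]
  refine (Polynomial.natDegree_C_mul_le _ _).trans ?_
  refine (Polynomial.natDegree_prod_le _ _).trans ?_
  refine Finset.sum_le_sum fun v _ => ?_
  rw [← pow_mul]
  exact (Polynomial.natDegree_X_pow_le _).trans (Nat.mul_comm _ _).le

/-- **(a)** On block-sub-multilinear polynomials the inverse Kronecker substitution
`κ : y_{(j,ℓ)} ↦ X^{ℓ k^j}` does not increase the number of monomials and has
`natDegree ≤ k^n - 1` (DST24, Remark 2 after Thm 3.2). [folklore] -/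
theorem dk_partA (n k : ℕ) (q : MvPolynomial (Fin n × Fin k) ℂ)
    (hq : ∀ m ∈ q.support, ∀ j : Fin n, ∑ l : Fin k, m (j, l) ≤ 1) :
    (MvPolynomial.aeval
        (fun v : Fin n × Fin k => (Polynomial.X : Polynomial ℂ) ^ ((v.2 : ℕ) * k ^ (v.1 : ℕ))) q).support.card
        ≤ q.support.card ∧
    (MvPolynomial.aeval
        (fun v : Fin n × Fin k => (Polynomial.X : Polynomial ℂ) ^ ((v.2 : ℕ) * k ^ (v.1 : ℕ))) q).natDegree
        ≤ k ^ n - 1 := by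
  refine ⟨card_support_aeval_le_of_isTerm (fun v => isTerm_X_pow _) q, ?_⟩
  conv_lhs => rw [q.as_sum, map_sum]
  refine Polynomial.natDegree_sum_le_of_forall_le _ _ fun m hm => ?_
  exact (dk_natDegree_aeval_monomial_le n k m _).trans (dk_expo_le n k m (hq m hm))

/-! ## (b) The one-hot digit lift -/

/-- A product of one variable from each block, `Π_j y_{(j, e j)}`, is set-multilinear over all
blocks. [folklore] -/
theorem dk_isSetMultilinear_prod (n k : ℕ) (e : Fin n → Fin k) :
    IsSetMultilinear (Prod.fst : Fin n × Fin k → Fin n) Finset.univ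
      (∏ j : Fin n, X (j, e j) : MvPolynomial (Fin n × Fin k) ℂ) := by
  have h := IsWeightedHomogeneous.prod (w := blockWeight (Prod.fst : Fin n × Fin k → Fin n))
    Finset.univ (fun j : Fin n => (X (j, e j) : MvPolynomial (Fin n × Fin k) ℂ))
    (fun j => blockWeight (Prod.fst : Fin n × Fin k → Fin n) (j, e j))
    (fun j _ => isWeightedHomogeneous_X ℂ _ _)
  unfold IsSetMultilinear blockProfile
  unfold blockWeight at h ⊢
  exact h

/-- Every digit lift `Σ_{m ∈ s} c_m Π_j y_{(j, d m j)}` is set-multilinear over all `n` blocks. [folklore] -/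
theorem dk_isSetMultilinear_lift (n k : ℕ) (s : Finset ℕ) (c : ℕ → ℂ) (d : ℕ → Fin n → Fin k) :
    IsSetMultilinear (Prod.fst : Fin n × Fin k → Fin n) Finset.univ
      (∑ m ∈ s, C (c m) * ∏ j : Fin n, X (j, d m j) : MvPolynomial (Fin n × Fin k) ℂ) := by
  refine IsSetMultilinear.sum _ s fun m _ => ?_
  rw [← smul_eq_C_mul]
  exact (dk_isSetMultilinear_prod n k (d m)).smul _ (c m)

/-- Every digit lift is homogeneous of degree `n`. [folklore] -/
theorem dk_isHomogeneous_lift (n k : ℕ) (s : Finset ℕ) (c : ℕ → ℂ) (d : ℕ → Fin n → Fin k) :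
    (∑ m ∈ s, C (c m) * ∏ j : Fin n, X (j, d m j) : MvPolynomial (Fin n × Fin k) ℂ).IsHomogeneous n := by
  refine IsHomogeneous.sum s _ n fun m _ => ?_
  refine IsHomogeneous.C_mul ?_ (c m)
  have h := IsHomogeneous.prod Finset.univ
    (fun j : Fin n => (X (j, d m j) : MvPolynomial (Fin n × Fin k) ℂ)) (fun _ => 1)
    fun j _ => isHomogeneous_X ℂ (j, d m j)
  simpa using h

/-- `Π_j y_{(j, e j)}` is the monomial with exponent `Σ_j single (j, e j) 1`. [folklore] -/
theorem dk_prod_X_eq_monomial (n k : ℕ) (e : Fin n → Fin k) :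
    (∏ j : Fin n, X (j, e j) : MvPolynomial (Fin n × Fin k) ℂ) =
      monomial (∑ j : Fin n, Finsupp.single (j, e j) 1) 1 := by
  rw [monomial_sum_one]
  rfl

/-- The exponent `Σ_j single (j, e j) 1` at `(j, l)` is `[e j = l]`. [folklore] -/
theorem dk_mono_apply (n k : ℕ) (e : Fin n → Fin k) (j : Fin n) (l : Fin k) :
    (∑ j' : Fin n, Finsupp.single (j', e j') 1 : Fin n × Fin k →₀ ℕ) (j, l) =
      if e j = l then 1 else 0 := by
  rw [Finsupp.finsetSum_apply, Finset.sum_eq_single j]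
  · simp [Finsupp.single_apply, Prod.ext_iff]
  · intro j' _ hj'
    simp [Prod.ext_iff, hj']
  · simp

/-- Distinct digit vectors give distinct digit monomials. [folklore] -/
theorem dk_mono_injective (n k : ℕ) {e e' : Fin n → Fin k}
    (h : (∑ j : Fin n, Finsupp.single (j, e j) 1 : Fin n × Fin k →₀ ℕ) =
      ∑ j : Fin n, Finsupp.single (j, e' j) 1) : e = e' := by
  funext j
  have hj := DFunLike.congr_fun h (j, e j)
  rw [dk_mono_apply, dk_mono_apply, if_pos rfl] at hj
  by_contra hne
  rw [if_neg (Ne.symm hne)] at hj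
  exact one_ne_zero hj

/-- The coefficient of a digit lift at the digit monomial of `m₀ ∈ s` is `c m₀`, provided no other
`m ∈ s` has the digit vector of `m₀`. [folklore] -/
theorem dk_coeff_lift (n k : ℕ) (s : Finset ℕ) (c : ℕ → ℂ) (d : ℕ → Fin n → Fin k) (m₀ : ℕ)
    (hm₀ : m₀ ∈ s) (hd : ∀ m ∈ s, d m = d m₀ → m = m₀) :
    coeff (∑ j : Fin n, Finsupp.single (j, d m₀ j) 1)
      (∑ m ∈ s, C (c m) * ∏ j : Fin n, X (j, d m j) : MvPolynomial (Fin n × Fin k) ℂ) = c m₀ := by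
  rw [coeff_sum, Finset.sum_eq_single m₀]
  · rw [coeff_C_mul, dk_prod_X_eq_monomial, coeff_monomial, if_pos rfl, mul_one]
  · intro m hm hne
    rw [coeff_C_mul, dk_prod_X_eq_monomial, coeff_monomial, if_neg, mul_zero]
    intro h
    exact hne (hd m hm (dk_mono_injective n k h))
  · intro h
    exact absurd hm₀ h

/-- A digit lift with a coefficient `c m₀ ≠ 0` whose digit vector is not repeated has total degree
exactly `n`. [folklore] -/
theorem dk_totalDegree_lift (n k : ℕ) (s : Finset ℕ) (c : ℕ → ℂ) (d : ℕ → Fin n → Fin k) (m₀ : ℕ)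
    (hm₀ : m₀ ∈ s) (hd : ∀ m ∈ s, d m = d m₀ → m = m₀) (hc : c m₀ ≠ 0) :
    (∑ m ∈ s, C (c m) * ∏ j : Fin n, X (j, d m j) : MvPolynomial (Fin n × Fin k) ℂ).totalDegree = n := by
  refine (dk_isHomogeneous_lift n k s c d).totalDegree fun h => hc ?_
  rw [← dk_coeff_lift n k s c d m₀ hm₀ hd, h, coeff_zero]

/-- `κ` maps a digit lift to `Σ_{m ∈ s} c_m X^m` as soon as the digits of every `m ∈ s` reassemble
`m`: `Σ_j (d m j) k^j = m` (DST24 eqs. (7)–(8)). [folklore] -/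
theorem dk_aeval_lift (n k : ℕ) (s : Finset ℕ) (c : ℕ → ℂ) (d : ℕ → Fin n → Fin k)
    (hd : ∀ m ∈ s, ∑ j : Fin n, (d m j : ℕ) * k ^ (j : ℕ) = m) :
    MvPolynomial.aeval
        (fun v : Fin n × Fin k => (Polynomial.X : Polynomial ℂ) ^ ((v.2 : ℕ) * k ^ (v.1 : ℕ)))
        (∑ m ∈ s, C (c m) * ∏ j : Fin n, X (j, d m j) : MvPolynomial (Fin n × Fin k) ℂ) =
      ∑ m ∈ s, Polynomial.C (c m) * Polynomial.X ^ m := by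
  -- adapted from Cruxes/SOSMagnification/Lines/gauss-sum-formula-witness.lean `kronFaithful`
  rw [map_sum]
  refine Finset.sum_congr rfl fun m hm => ?_
  rw [map_mul, MvPolynomial.aeval_C, map_prod, ← Polynomial.C_eq_algebraMap]
  congr 1
  simp only [MvPolynomial.aeval_X]
  rw [Finset.prod_pow_eq_pow_sum, hd m hm]

/-- Base-`k` expansion: `Σ_{j<n} (m / k^j % k)·k^j = m` for `m < kⁿ`. [folklore] -/
theorem dk_sum_digit_mul_pow (k : ℕ) (hk : 0 < k) :
    ∀ (n m : ℕ), m < k ^ n → ∑ j : Fin n, (m / k ^ (j : ℕ) % k) * k ^ (j : ℕ) = m := by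
  -- adapted from Cruxes/SOSMagnification/Lines/gauss-sum-formula-witness.lean `sum_digit_mul_pow`
  intro n
  induction n with
  | zero =>
    intro m hm
    rw [pow_zero] at hm
    have hm0 : m = 0 := by omega
    subst hm0
    simp
  | succ n ih =>
    intro m hm
    rw [Fin.sum_univ_succ]
    simp only [Fin.val_zero, pow_zero, Nat.div_one, mul_one, Fin.val_succ]
    have hm' : m / k < k ^ n := by
      rw [Nat.div_lt_iff_lt_mul hk]
      calc m < k ^ (n + 1) := hm
        _ = k ^ n * k := pow_succ k n
    have hterm : ∀ j : Fin n, m / k ^ ((j : ℕ) + 1) % k * k ^ ((j : ℕ) + 1)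
        = k * ((m / k) / k ^ (j : ℕ) % k * k ^ (j : ℕ)) := by
      intro j
      rw [pow_succ', Nat.div_div_eq_div_mul]
      ring
    simp only [hterm, ← Finset.mul_sum]
    rw [ih (m / k) hm']
    exact Nat.mod_add_div m k

/-! ## The registered stub -/

/-- **Stub T2 `stub_digitKronecker` (digit lift ⟷ Kronecker substitution).** (a) For every `q`
whose monomials take at most one variable (to the first power) from each digit block,
`κ = aeval (y_{(j,ℓ)} ↦ X^{ℓ k^j})` does not increase the number of monomials and
`natDegree (κ q) ≤ k^n − 1`; (b) for a prime `p ≤ k^n` the one-hot base-`k` digit lift of the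
Fekete polynomial is set-multilinear over all blocks, has total degree exactly `n`, and `κ` maps it
to `F_p = Σ_{m<p} (m|p) X^m` (Dutta–Saxena–Thierauf 2024, Remark 2 after Thm 3.2, eqs. (7)–(8)). [folklore] -/
theorem stub_digitKronecker :
    (∀ (n k : ℕ) (q : MvPolynomial (Fin n × Fin k) ℂ),
      (∀ m ∈ q.support, ∀ j : Fin n, ∑ l : Fin k, m (j, l) ≤ 1) →
      (MvPolynomial.aeval (fun v : Fin n × Fin k => (Polynomial.X : Polynomial ℂ) ^ ((v.2 : ℕ) * k ^ (v.1 : ℕ))) q).support.card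
          ≤ q.support.card ∧
      (MvPolynomial.aeval (fun v : Fin n × Fin k => (Polynomial.X : Polynomial ℂ) ^ ((v.2 : ℕ) * k ^ (v.1 : ℕ))) q).natDegree
          ≤ k ^ n - 1) ∧
    (∀ (k : ℕ) [NeZero k] (p : ℕ) [Fact p.Prime] (n : ℕ), p ≤ k ^ n →
      IsSetMultilinear (Prod.fst : Fin n × Fin k → Fin n) Finset.univ
        (∑ m ∈ Finset.range p, C ((legendreSym p m : ℤ) : ℂ) *
          ∏ j : Fin n, X (j, (⟨m / k ^ (j : ℕ) % k, Nat.mod_lt _ (Nat.pos_of_neZero k)⟩ : Fin k)) :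
            MvPolynomial (Fin n × Fin k) ℂ) ∧
      (∑ m ∈ Finset.range p, C ((legendreSym p m : ℤ) : ℂ) *
          ∏ j : Fin n, X (j, (⟨m / k ^ (j : ℕ) % k, Nat.mod_lt _ (Nat.pos_of_neZero k)⟩ : Fin k)) :
            MvPolynomial (Fin n × Fin k) ℂ).totalDegree = n ∧
      MvPolynomial.aeval (fun v : Fin n × Fin k => (Polynomial.X : Polynomial ℂ) ^ ((v.2 : ℕ) * k ^ (v.1 : ℕ)))
          (∑ m ∈ Finset.range p, C ((legendreSym p m : ℤ) : ℂ) *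
            ∏ j : Fin n, X (j, (⟨m / k ^ (j : ℕ) % k, Nat.mod_lt _ (Nat.pos_of_neZero k)⟩ : Fin k)) :
              MvPolynomial (Fin n × Fin k) ℂ) =
        ∑ m ∈ Finset.range p, Polynomial.C ((legendreSym p m : ℤ) : ℂ) * Polynomial.X ^ m) := by
  refine ⟨fun n k q hq => dk_partA n k q hq, ?_⟩
  intro k _ p _ n hp
  have hk : 0 < k := Nat.pos_of_neZero k
  have h1 : 1 ∈ Finset.range p := Finset.mem_range.2 (Fact.out : p.Prime).one_lt
  -- faithfulness of the digits below `k ^ n ≥ p`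
  have hfaith : ∀ m ∈ Finset.range p,
      ∑ j : Fin n, (((fun m j => ⟨m / k ^ (j : ℕ) % k, Nat.mod_lt _ (Nat.pos_of_neZero k)⟩ :
        ℕ → Fin n → Fin k) m j : Fin k) : ℕ) * k ^ (j : ℕ) = m := fun m hm =>
    dk_sum_digit_mul_pow k hk n m (lt_of_lt_of_le (Finset.mem_range.1 hm) hp)
  -- hence the digit vectors of distinct `m < p` are distinct
  have hinj : ∀ m ∈ Finset.range p,
      ((fun m j => ⟨m / k ^ (j : ℕ) % k, Nat.mod_lt _ (Nat.pos_of_neZero k)⟩ : ℕ → Fin n → Fin k) m =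
        (fun m j => ⟨m / k ^ (j : ℕ) % k, Nat.mod_lt _ (Nat.pos_of_neZero k)⟩ : ℕ → Fin n → Fin k) 1) →
      m = 1 := by
    intro m hm h
    rw [← hfaith m hm, ← hfaith 1 h1]
    simp only [funext_iff, Fin.mk.injEq] at h
    exact Finset.sum_congr rfl fun j _ => by dsimp only; rw [h j]
  have hc : (fun m : ℕ => ((legendreSym p m : ℤ) : ℂ)) 1 ≠ 0 := by
    simp only [Nat.cast_one, legendreSym.at_one, Int.cast_one]
    exact one_ne_zero
  exact ⟨dk_isSetMultilinear_lift n k _ (fun m : ℕ => ((legendreSym p m : ℤ) : ℂ)) _,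
    dk_totalDegree_lift n k _ (fun m : ℕ => ((legendreSym p m : ℤ) : ℂ)) _ 1 h1 hinj hc,
    dk_aeval_lift n k _ (fun m : ℕ => ((legendreSym p m : ℤ) : ℂ)) _ hfaith⟩

end Summit.ValiantsHypothesis.ValiantsHypothesis.Theorems.FeketeSOSSOSMagnification
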